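import Literature.AnabelianGeometry.SemiGraphs.PSCSeparatingCoveringsSameVertex
import Literature.AnabelianGeometry.SemiGraphs.ProSigmaCompletionProfiniteExtend
import Literature.AnabelianGeometry.SemiGraphs.ProSigmaCompletionInjective
import HarnessLib

/-!
# [CombGC] Prop. 1.2, proof p. 9: the verticial separating covering for level vertices over DISTINCT vertices, and row P12-L01-V at two-free-factor data

Mochizuki, *A combinatorial version of the Grothendieck conjecture*, Tohoku Math. J. **59** (2007)
[CombGC], PROOF of Proposition 1.2, author's manuscript p. 9 ("… there exists a finite étale …
covering `G' → G` whose restriction to the anabelioid `G_{v₂}` is trivial …, but whose restriction to the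
anabelioid `G_{v₁}` is nontrivial") [cite: MochizukiCombGC2007, Prop 1.2 proof p.9]; typed LEVEL-WISE as
`PSCDatum.VerticialSeparatingCoverings` (`PSCSeparatingCoverings.lean`, row P12-L01-V, verticial conjunct
of abc-iut FACT-LIST rows F-2829 / F-2830).  PROOF-ONLY companion (abc-iut-f-166 gen 3) of
`PSCSeparatingCoveringsSameVertex.lean`, which did the case of two level vertices over the SAME vertex by
the fibred twist.  Here:

* `IsProSigmaCompletion.freeFactor_exists_open_separating_crossVertex` — level vertices over two
  DIFFERENT vertex groups `A₁`, `A₂` of `Π`, where `A₂ = cl ι⟨b(S)⟩` is the closure of a free factor of the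
  discrete group `Γ` along the pro-`Σ` completion `ι : Γ → Π` and `A₁` contains some `ι(a)` NOT killed by
  the projection `ρ : Γ → Γ`, `b_j ↦ 1 (j ∈ S)`, `b_j ↦ b_j (j ∉ S)`: the PROJECTION argument — the
  continuous extension `F : Π → Π` of `ι ∘ ρ` (`exists_continuous_extend_profinite`) kills `A₂` and all
  its conjugates, while `F(γ₁ ι(a)^m γ₁⁻¹) = F(γ₁) ι(ρ(a))^m F(γ₁)⁻¹ ≠ 1` (`ι` injective on the free group
  `Γ`, `injective_of_isFreeGroup`; free groups are torsion-free), `m = [Γ : ι⁻¹V]`; an open normal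
  `V₀ ⊴ Π` missing `ι(ρ(a))^m` gives `U := V ∩ F⁻¹(V₀)`.  No double-coset hypothesis is needed.
* `PSCDatum.verticialSeparatingCoverings_of_freeFactors'` — **row P12-L01-V** (`V' := V`) for every
  datum ALL of whose vertex groups are closures of free factors `cl ι⟨b_v(S_v)⟩` (one free basis of `Γ`
  per vertex) such that for `v₁ ≠ v₂` some `ι(a) ∈ Π_{v₁}` survives the projection killing `b_{v₂}(S_{v₂})`
  — the shape of the genuine two-component affine data of abc-iut-f-164 (`Π_{v₀} = cl ι⟨a_i,b_i (i<g₀),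
  c_j (j ≥ s)⟩` in the `c₀`-eliminating free basis of `Γ_{g,r}`, `Π_{v₁} = cl ι⟨a_i, b_i (i ≥ g₀),
  c_j (j<s)⟩` in a `c_s`-eliminating one; `c_{s+1}` resp. `c_1` survive).  Same-vertex pairs:
  `PSCDatum.exists_sameVertex_separating_of_freeFactor`.

Instance forms at data of free-factor shape (consistency evidence for the typed schema F-2829); not the
printed statement for all pointed stable curves.  0 definitions; nothing here takes a side on
[IUTchIII] Cor. 3.12.
-/

noncomputable section

namespace Literature.AnabelianGeometry.SemiGraphs

open scoped Pointwise
open Literature.AnabelianGeometry.Anabelioids (IsSigmaInteger)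
open Literature.GroupTheory.CombinatorialGroupTheory

universe u

namespace SemiGraphOfAnabelioids.IsProSigmaCompletion

variable {Sigma : Set ℕ} {Γ : Type u} [Group Γ] {P : Type u} [Group P] [TopologicalSpace P]
  [IsTopologicalGroup P] [CompactSpace P] [TotallyDisconnectedSpace P] {ι : Γ →* P}

/-- **[CombGC] Prop. 1.2, proof p. 9 — the verticial separating covering over two DISTINCT vertices,
free-factor form (projection).**  `ι : Γ → Π` a pro-`Σ` completion (`Π` profinite, `Σ ∋` a prime) of a
free group `Γ` with basis `b`; `A₂ = cl ι⟨b(S)⟩`; `ρ : Γ → Γ` the projection killing the letters of `S`;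
`A₁ ≤ Π` containing `ι(a)` with `ρ(a) ≠ 1`; `V ⊴ Π` open.  Then for ALL `γ₁, γ₂` there is an open `U ≤ V`,
normal in `V`, with `γ₂A₂γ₂⁻¹ ∩ V ≤ U` and `γ₁A₁γ₁⁻¹ ∩ V ⊄ U`. [cite: MochizukiCombGC2007, Prop 1.2 proof p.9] -/
theorem freeFactor_exists_open_separating_crossVertex (hι : IsProSigmaCompletion Sigma ι)
    (hSig : ∃ ℓ ∈ Sigma, ℓ.Prime) {β : Type*} (b : FreeGroupBasis β Γ) (S : Set β)
    [DecidablePred (· ∈ S)] (ρ : Γ →* Γ) (hρ : ∀ j, ρ (b j) = if j ∈ S then 1 else b j)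
    (A₂ : Subgroup P) (hA₂ : A₂ = ((Subgroup.closure (b '' S)).map ι).topologicalClosure)
    (A₁ : Subgroup P) (a : Γ) (haA : ι a ∈ A₁) (hρa : ρ a ≠ 1)
    (V : Subgroup P) [hVn : V.Normal] (hVo : IsOpen (V : Set P)) (γ₁ γ₂ : ConjAct P) :
    ∃ U : Subgroup P, IsOpen (U : Set P) ∧ U ≤ V ∧ (U.subgroupOf V).Normal ∧
      (γ₂ • A₂) ⊓ V ≤ U ∧ ¬ ((γ₁ • A₁) ⊓ V ≤ U) := by
  classical
  haveI : IsFreeGroup Γ := b.isFreeGroup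
  -- the continuous extension `F` of `ι ∘ ρ`
  obtain ⟨F, hFc, hF⟩ := exists_continuous_extend_profinite hι hι.index_open (ι.comp ρ)
  -- `F` kills `A₂`
  have hρS : ∀ x ∈ Subgroup.closure (b '' S), ρ x = 1 := by
    intro x hx
    refine Subgroup.closure_induction (p := fun x _ => ρ x = 1) ?_ (map_one ρ) ?_ ?_ hx
    · rintro _ ⟨j, hj, rfl⟩
      rw [hρ j, if_pos hj]
    · intro x y _ _ hx hy
      rw [map_mul, hx, hy, mul_one]
    · intro x _ hx
      rw [map_inv, hx, inv_one]
  have hkerc : IsClosed ((F.ker : Subgroup P) : Set P) := by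
    have h : ((F.ker : Subgroup P) : Set P) = F ⁻¹' {1} := by
      ext x
      simp only [SetLike.mem_coe, MonoidHom.mem_ker, Set.mem_preimage, Set.mem_singleton_iff]
    rw [h]
    exact isClosed_singleton.preimage hFc
  have hA₂F : A₂ ≤ F.ker := by
    rw [hA₂]
    refine Subgroup.topologicalClosure_minimal _ ?_ hkerc
    rintro _ ⟨x, hx, rfl⟩
    rw [MonoidHom.mem_ker, hF x, MonoidHom.comp_apply, hρS x hx, map_one]
  -- the surviving element `y = ι(ρ a)^m`, `m = [Γ : ι⁻¹ V]`
  haveI : (V.comap ι).FiniteIndex := finiteIndex_comap hι V hVo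
  set m : ℕ := (V.comap ι).index with hm
  have hm0 : 0 < m := Nat.pos_of_ne_zero (Subgroup.FiniteIndex.index_ne_zero)
  have ham : a ^ m ∈ V.comap ι := Subgroup.pow_index_mem _ a
  have hy1 : ι (ρ a ^ m) ≠ 1 := by
    intro h
    have h1 : ρ a ^ m = 1 := injective_of_isFreeGroup hι hSig (by rw [h, map_one])
    exact not_isOfFinOrder_of_isFreeGroup hρa (isOfFinOrder_iff_pow_eq_one.mpr ⟨m, hm0, h1⟩)
  -- an open normal `V₀ ⊴ Π` missing `y`
  obtain ⟨V₀, hV₀⟩ := ProfiniteGrp.exist_openNormalSubgroup_sub_open_nhds_of_one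
    (isOpen_compl_singleton (x := ι (ρ a ^ m))) (by
      rw [Set.mem_compl_singleton_iff]; exact fun h => hy1 h.symm)
  have hyV₀ : ι (ρ a ^ m) ∉ (V₀ : Subgroup P) := fun h => (hV₀ h) rfl
  -- `U := V ∩ F⁻¹(V₀)`
  haveI hV₀n : ((V₀ : Subgroup P).comap F).Normal := V₀.isNormal'.comap F
  have hWo : IsOpen (((V₀ : Subgroup P).comap F : Subgroup P) : Set P) := V₀.isOpen'.preimage hFc
  refine ⟨V ⊓ (V₀ : Subgroup P).comap F, hVo.inter hWo, inf_le_left,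
    (Subgroup.normal_inf_normal V _).subgroupOf V, ?_, ?_⟩
  · -- trivial over the vertex of `γ₂`: `F` kills `γ₂ A₂ γ₂⁻¹`
    refine le_inf inf_le_right ?_
    intro x hx
    have hx' : x ∈ γ₂ • (F.ker : Subgroup P) :=
      Subgroup.pointwise_smul_le_pointwise_smul_iff.mpr hA₂F hx.1
    rw [(inferInstance : (F.ker : Subgroup P).Normal).conjAct γ₂, MonoidHom.mem_ker] at hx'
    rw [Subgroup.mem_comap, hx']
    exact one_mem _
  · -- nontrivial over the vertex of `γ₁`: the element `γ₁ ι(a)^m γ₁⁻¹`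
    intro hle
    set g : P := ConjAct.ofConjAct γ₁ with hg
    have hxA : g * ι (a ^ m) * g⁻¹ ∈ (γ₁ • A₁) ⊓ V := by
      refine Subgroup.mem_inf.mpr ⟨?_, hVn.conj_mem _ ham g⟩
      rw [Subgroup.mem_pointwise_smul_iff_inv_smul_mem, ConjAct.smul_def, map_inv, ← hg]
      have e : g⁻¹ * (g * ι (a ^ m) * g⁻¹) * g⁻¹⁻¹ = ι (a ^ m) := by group
      rw [e, map_pow]
      exact A₁.pow_mem haA m
    have hxU := hle hxA
    have hxV₀ : F (g * ι (a ^ m) * g⁻¹) ∈ (V₀ : Subgroup P) := (Subgroup.mem_inf.mp hxU).2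
    rw [map_mul, map_mul, map_inv, hF, MonoidHom.comp_apply, map_pow ρ] at hxV₀
    have h2 := V₀.isNormal'.conj_mem _ hxV₀ (F g)⁻¹
    have e : (F g)⁻¹ * (F g * ι (ρ a ^ m) * (F g)⁻¹) * (F g)⁻¹⁻¹ = ι (ρ a ^ m) := by group
    rw [e] at h2
    exact hyV₀ h2

end SemiGraphOfAnabelioids.IsProSigmaCompletion

/-! ### Row P12-L01-V at two-free-factor data -/

namespace PSCDatum

open SemiGraphOfAnabelioids (IsProSigmaCompletion)
open SemiGraphOfAnabelioids.IsProSigmaCompletion (freeFactor_exists_open_separating_crossVertex)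

variable {Sigma : Set ℕ} {Γ : Type u} [Group Γ] {P : Type u} [Group P] [TopologicalSpace P]
  [IsTopologicalGroup P] [CompactSpace P] [TotallyDisconnectedSpace P] {ι : Γ →* P}

/-- **Row P12-L01-V (`VerticialSeparatingCoverings`, the verticial conjunct of F-2829) at data all of
whose vertex groups are closures of free factors**, fully explicit form.  Data: a pro-`Σ` completion
`ι : Γ → Π` of a free group (`Π` profinite, `Σ ∋` a prime); for every vertex `v` a free basis `b_v` of
`Γ`, a nonempty `S_v`, with `Π_v = cl ι⟨b_v(S_v)⟩`, and the projection `ρ_v` killing `b_v(S_v)`; for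
`v₁ ≠ v₂` an `a ∈ Γ` with `ι(a) ∈ Π_{v₁}` and `ρ_{v₂}(a) ≠ 1`.  Then at EVERY open normal level `V`
(`V' := V`) any two distinct level-`V` vertices are separated: over the same vertex by the fibred twist
(`exists_sameVertex_separating_of_freeFactor`), over distinct vertices by projection
(`freeFactor_exists_open_separating_crossVertex`). [cite: MochizukiCombGC2007, Prop 1.2 proof p.9] -/
theorem verticialSeparatingCoverings_of_freeFactors' (hι : IsProSigmaCompletion Sigma ι)
    (hSig : ∃ ℓ ∈ Sigma, ℓ.Prime) {β : Type*} (G : PSCDatum P)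
    (bs : G.graph.V → FreeGroupBasis β Γ) (Ss : G.graph.V → Set β) [∀ v, DecidablePred (· ∈ Ss v)]
    (hSs : ∀ v, (Ss v).Nonempty)
    (hv : ∀ v, G.vertGp v = ((Subgroup.closure (bs v '' Ss v)).map ι).topologicalClosure)
    (ρs : G.graph.V → (Γ →* Γ)) (hρs : ∀ v j, ρs v (bs v j) = if j ∈ Ss v then 1 else bs v j)
    (hsep : ∀ v₁ v₂ : G.graph.V, v₁ ≠ v₂ → ∃ a : Γ, ι a ∈ G.vertGp v₁ ∧ ρs v₂ a ≠ 1) :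
    G.VerticialSeparatingCoverings :=
  G.verticialSeparatingCoverings_of_freeFactors hι hSig bs Ss hSs hv fun V hVn hVo v₁ v₂ γ₁ γ₂ h12 => by
    haveI := hVn
    obtain ⟨a, haA, hρa⟩ := hsep v₁ v₂ h12
    exact freeFactor_exists_open_separating_crossVertex hι hSig (bs v₂) (Ss v₂) (ρs v₂) (hρs v₂)
      (G.vertGp v₂) (hv v₂) (G.vertGp v₁) a haA hρa V hVo γ₁ γ₂

end PSCDatum

end Literature.AnabelianGeometry.SemiGraphs

end
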